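import Summits.RiemannHypothesis.RiemannHypothesis.Theses.LiDirichletAsymptotic
import Summits.RiemannHypothesis.RiemannHypothesis.Theorems.LiDirichletAsymptoticFarTailsCharCount
import HarnessLib

/-!
# RiemannHypothesis / LiDirichletAsymptotic — support S2χ `LiFarTailsChar`: the RH-FREE far tails (RH-FREE · GRH-FREE)

RH-FREE · GRH-FREE PROOF-OF-DATA (rung L-P(P1⁺χ)) [rh-li-prover].  Route `Theses/LiDirichletAsymptotic.lean`
(cell `pub/rh-li`, round 5 (iii)), support item `LiFarTailsChar` (stmt-RiemannHypothesis-19632): for `χ` primitive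
mod `q > 1` and `1000 ≤ T ≤ U`,

  `Σ_{T<|γ|≤U} m/|γ|³ ≤ log(qT)/(πT²)`  and  `Σ_{T<|γ|≤U} m/γ⁴ ≤ log(qT)/(2πT³)`

(`charInvMomentTail χ 3 T U`, `charInvMomentTail χ 4 T U`).  The χ-twin of the closed ζ items
`LiFarZeroTail`/`LiFarZeroTailCube`: partial summation of `t⁻ᵏ` against the two-sided count `N(t, χ)`, bracketed RH-free
by the explicit `N±` of the helper `Theorems/LiDirichletAsymptoticFarTailsCharCount.lean`, an explicit antiderivative of
`k(N⁺(t) − c)/t^{k+1}`; main terms `(log(qT/2π) + 1/2)/(2πT²)` resp. `(log(qT/2π) + 1/3)/(3πT³)`, the slack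
`(log(qT) + log 2π − 1/2)/(2πT²)` resp. `(log(qT) + 2 log 2π − 2/3)/(6πT³)` absorbing the remainders
`(25.95 log(qT) + 73.6)/T^k` once `T ≥ 1000` (tight corner `T = 1000`, `q = 2`: a factor `> 2` in hand).
Nothing here bears on the truth of RH or GRH: nothing about the real parts of the zeros is used.
-/

noncomputable section

-- D-0017: `Summit.<S>.<S>.…` is the designed namespace of a single-problem summit.
set_option linter.dupNamespace false

open Real Set MeasureTheory intervalIntegral
open scoped Real

namespace Summit.RiemannHypothesis.RiemannHypothesis.Theorems.LiTheory

open Literature.NumberTheory.LFunctions Literature.NumberTheory.LFunctions.SchoenfeldBound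
open Literature.NumberTheory.LFunctions.ExplicitPsiChar Literature.NumberTheory.LFunctions.DirichletTheta
open Literature.NumberTheory.LFunctions.DirichletDisc (zeroOrder)


open FarTailsChar

/-- **The cubic far tail (S2χ, RH-FREE).**  For `χ` primitive mod `q > 1` and `1000 ≤ T ≤ U`:
`Σ_{T<|γ|≤U} m/|γ|³ ≤ log(qT)/(πT²)`. -/
theorem charInvMomentTail_three_le (q : ℕ) [NeZero q] (χ : DirichletCharacter ℂ q) (hχ : χ.IsPrimitive)
    (hq : 1 < q) {T U : ℝ} (hT : 1000 ≤ T) (hTU : T ≤ U) :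
    charInvMomentTail χ 3 T U ≤ Real.log (q * T) / (Real.pi * T ^ 2) := by
  have hχ1 : χ ≠ 1 := ne_one_of_isPrimitive hχ hq
  have hT0 : 0 < T := by linarith
  have hU0 : 0 < U := by linarith
  have hπ := Real.pi_pos
  have hq0 : (0 : ℝ) < q := by exact_mod_cast (lt_trans zero_lt_one hq)
  obtain ⟨hL0, hlogT, h2π, h2π'⟩ := logs hq hT
  have hA := remC_le hq
  have hA0 := remC_nonneg hq
  have hps := pi_mul_slope q
  -- the sum rewritten with `(·)⁻¹`
  have hsum : charInvMomentTail χ 3 T U =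
      ∑ᶠ ρ ∈ lfunctionZeroBox χ U \ lfunctionZeroBox χ T,
        (zeroOrder χ ρ : ℝ) * (fun t : ℝ ↦ (t ^ 3)⁻¹) |ρ.im| := by
    unfold charInvMomentTail
    exact finsum_congr fun ρ ↦ by rw [div_eq_mul_inv]
  rw [hsum]
  -- partial summation with `F = t⁻³`, `N ≤ N⁺` on `[T, U]`
  have h := finsum_window_le_of_count_le hχ1 hTU (F := fun t ↦ (t ^ 3)⁻¹) (F' := fun t ↦ -3 / t ^ 4)
    (Nup := nUp q) (fun t ht ↦ hasDerivAt_inv_cube (by linarith [ht.1] : t ≠ 0))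
    (continuousOn_of_forall_continuousAt fun t ht ↦ by
      have h0 : t ≠ 0 := by linarith [ht.1]
      have h4 : t ^ 4 ≠ 0 := pow_ne_zero 4 h0
      fun_prop (disch := assumption))
    (fun t ht ↦ by
      have : 0 < t := by linarith [ht.1]
      exact div_nonpos_of_nonpos_of_nonneg (by norm_num) (by positivity))
    (by positivity) (fun t ht ↦ count_le_nUp hχ hq (by linarith [ht.1]))
    (fun t ht ↦ (continuousAt_nUp q (by linarith [ht.1])).continuousWithinAt)
  -- replace `N(T)` by `N⁻(T)`
  have hN := nLo_le_count hχ hq hT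
  have hbd : (nUp q U - lfunctionZeroCount χ T) * (U ^ 3)⁻¹ ≤ (nUp q U - nLo q T) * (U ^ 3)⁻¹ :=
    mul_le_mul_of_nonneg_right (by linarith) (by positivity)
  have hcont : ∀ c' : ℝ, ContinuousOn (fun t ↦ (nUp q t - c') * -(-3 / t ^ 4)) (Icc T U) := fun c' ↦
    continuousOn_of_forall_continuousAt fun t ht ↦ by
      have h0 : t ≠ 0 := by linarith [ht.1]
      have h4 : t ^ 4 ≠ 0 := pow_ne_zero 4 h0
      refine ((continuousAt_nUp q h0).sub continuousAt_const).mul ?_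
      fun_prop (disch := assumption)
  have hint_le : ∫ t in T..U, (nUp q t - lfunctionZeroCount χ T) * -(-3 / t ^ 4) ≤
      ∫ t in T..U, (nUp q t - nLo q T) * -(-3 / t ^ 4) := by
    refine integral_mono_on hTU ((hcont _).intervalIntegrable_of_Icc hTU)
      ((hcont _).intervalIntegrable_of_Icc hTU) fun t ht ↦ ?_
    have : 0 < t := by linarith [ht.1]
    have : 0 ≤ -(-3 / t ^ 4) := by rw [neg_div, neg_neg]; positivity
    nlinarith
  -- evaluate the integral by the antiderivative
  have hFTC : ∫ t in T..U, (nUp q t - nLo q T) * -(-3 / t ^ 4) = F3 q (nLo q T) U - F3 q (nLo q T) T := by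
    refine integral_eq_sub_of_hasDerivAt (fun t ht ↦ ?_) ((hcont _).intervalIntegrable_of_Icc hTU)
    rw [uIcc_of_le hTU] at ht
    exact hasDerivAt_F3 q _ (by linarith [ht.1])
  -- the `U`-end is non-positive
  have hrem : (nUp q U - nLo q T) * (U ^ 3)⁻¹ + F3 q (nLo q T) U ≤ 0 := by
    rw [boundary_add_F3_eq q _ hU0, hps]
    have hlogU : 6.75 ≤ Real.log U := hlogT.trans (Real.log_le_log hT0 hTU)
    have : 0 ≤ (Real.log U + (Real.log q - 1 - Real.log (2 * π)) + 3 / 2) / (2 * π) * (U ^ 2)⁻¹ := by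
      have : 0 ≤ Real.log U + (Real.log q - 1 - Real.log (2 * π)) + 3 / 2 := by linarith
      positivity
    have : (0 : ℝ) ≤ 12.975 / 3 * (U ^ 3)⁻¹ := by positivity
    linarith
  -- the value at `T`
  have hmain : -F3 q (nLo q T) T ≤ Real.log (q * T) / (π * T ^ 2) := by
    rw [neg_F3_nLo_eq q hT0, hps, Real.log_mul hq0.ne' hT0.ne']
    set L := Real.log q with hL
    have e2 : (L + Real.log T) / (π * T ^ 2) =
        (Real.log T + (L - 1 - Real.log (2 * π)) + 3 / 2) / (2 * π) * (T ^ 2)⁻¹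
          + (L + Real.log T + Real.log (2 * π) - 1 / 2) / (2 * π) * (T ^ 2)⁻¹ := by
      field_simp
      ring
    rw [e2]
    have key : (2 * 12.975 * Real.log T + 12.975 / 3 + 2 * remC q) * (T ^ 3)⁻¹ ≤
        (L + Real.log T + Real.log (2 * π) - 1 / 2) / (2 * π) * (T ^ 2)⁻¹ := by
      rw [show (T ^ 3)⁻¹ = T⁻¹ * (T ^ 2)⁻¹ by rw [← mul_inv, ← pow_succ'], ← mul_assoc]
      refine mul_le_mul_of_nonneg_right ?_ (by positivity)
      rw [← div_eq_mul_inv, div_le_div_iff₀ hT0 (by positivity)]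
      have hB : 2 * π ≤ 6.3 := by linarith [Real.pi_lt_d2]
      have hlogT0 : 0 ≤ Real.log T := by linarith
      have hX0 : 0 ≤ 2 * 12.975 * Real.log T + 12.975 / 3 + 2 * remC q := by positivity
      have hX : 2 * 12.975 * Real.log T + 12.975 / 3 + 2 * remC q ≤
          25.95 * Real.log T + 25.95 * L + 73.57 := by linarith
      have hP1 : 1000 * L ≤ T * L := mul_le_mul_of_nonneg_right hT hL0
      have hP2 : 1000 * Real.log T ≤ T * Real.log T := mul_le_mul_of_nonneg_right hT hlogT0
      calc (2 * 12.975 * Real.log T + 12.975 / 3 + 2 * remC q) * (2 * π)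
          ≤ (25.95 * Real.log T + 25.95 * L + 73.57) * 6.3 := mul_le_mul hX hB (by positivity) (by positivity)
        _ ≤ (L + Real.log T + Real.log (2 * π) - 1 / 2) * T := by nlinarith
    linarith
  linarith [h, hbd, hint_le, hFTC, hrem, hmain]

/-- **The quartic far tail (S2χ, RH-FREE).**  For `χ` primitive mod `q > 1` and `1000 ≤ T ≤ U`:
`Σ_{T<|γ|≤U} m/γ⁴ ≤ log(qT)/(2πT³)`. -/
theorem charInvMomentTail_four_le (q : ℕ) [NeZero q] (χ : DirichletCharacter ℂ q) (hχ : χ.IsPrimitive)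
    (hq : 1 < q) {T U : ℝ} (hT : 1000 ≤ T) (hTU : T ≤ U) :
    charInvMomentTail χ 4 T U ≤ Real.log (q * T) / (2 * Real.pi * T ^ 3) := by
  have hχ1 : χ ≠ 1 := ne_one_of_isPrimitive hχ hq
  have hT0 : 0 < T := by linarith
  have hU0 : 0 < U := by linarith
  have hπ := Real.pi_pos
  have hq0 : (0 : ℝ) < q := by exact_mod_cast (lt_trans zero_lt_one hq)
  obtain ⟨hL0, hlogT, h2π, h2π'⟩ := logs hq hT
  have hA := remC_le hq
  have hA0 := remC_nonneg hq
  have hps := pi_mul_slope q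
  have hsum : charInvMomentTail χ 4 T U =
      ∑ᶠ ρ ∈ lfunctionZeroBox χ U \ lfunctionZeroBox χ T,
        (zeroOrder χ ρ : ℝ) * (fun t : ℝ ↦ (t ^ 4)⁻¹) |ρ.im| := by
    unfold charInvMomentTail
    exact finsum_congr fun ρ ↦ by rw [div_eq_mul_inv]
  rw [hsum]
  have h := finsum_window_le_of_count_le hχ1 hTU (F := fun t ↦ (t ^ 4)⁻¹) (F' := fun t ↦ -4 / t ^ 5)
    (Nup := nUp q) (fun t ht ↦ FarZeroTail.hasDerivAt_inv_pow4 (by linarith [ht.1] : t ≠ 0))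
    (continuousOn_of_forall_continuousAt fun t ht ↦ by
      have h0 : t ≠ 0 := by linarith [ht.1]
      have h5 : t ^ 5 ≠ 0 := pow_ne_zero 5 h0
      fun_prop (disch := assumption))
    (fun t ht ↦ by
      have : 0 < t := by linarith [ht.1]
      exact div_nonpos_of_nonpos_of_nonneg (by norm_num) (by positivity))
    (by positivity) (fun t ht ↦ count_le_nUp hχ hq (by linarith [ht.1]))
    (fun t ht ↦ (continuousAt_nUp q (by linarith [ht.1])).continuousWithinAt)
  have hN := nLo_le_count hχ hq hT
  have hbd : (nUp q U - lfunctionZeroCount χ T) * (U ^ 4)⁻¹ ≤ (nUp q U - nLo q T) * (U ^ 4)⁻¹ :=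
    mul_le_mul_of_nonneg_right (by linarith) (by positivity)
  have hcont : ∀ c' : ℝ, ContinuousOn (fun t ↦ (nUp q t - c') * -(-4 / t ^ 5)) (Icc T U) := fun c' ↦
    continuousOn_of_forall_continuousAt fun t ht ↦ by
      have h0 : t ≠ 0 := by linarith [ht.1]
      have h5 : t ^ 5 ≠ 0 := pow_ne_zero 5 h0
      refine ((continuousAt_nUp q h0).sub continuousAt_const).mul ?_
      fun_prop (disch := assumption)
  have hint_le : ∫ t in T..U, (nUp q t - lfunctionZeroCount χ T) * -(-4 / t ^ 5) ≤
      ∫ t in T..U, (nUp q t - nLo q T) * -(-4 / t ^ 5) := by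
    refine integral_mono_on hTU ((hcont _).intervalIntegrable_of_Icc hTU)
      ((hcont _).intervalIntegrable_of_Icc hTU) fun t ht ↦ ?_
    have : 0 < t := by linarith [ht.1]
    have : 0 ≤ -(-4 / t ^ 5) := by rw [neg_div, neg_neg]; positivity
    nlinarith
  have hFTC : ∫ t in T..U, (nUp q t - nLo q T) * -(-4 / t ^ 5) = F4 q (nLo q T) U - F4 q (nLo q T) T := by
    refine integral_eq_sub_of_hasDerivAt (fun t ht ↦ ?_) ((hcont _).intervalIntegrable_of_Icc hTU)
    rw [uIcc_of_le hTU] at ht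
    exact hasDerivAt_F4 q _ (by linarith [ht.1])
  have hrem : (nUp q U - nLo q T) * (U ^ 4)⁻¹ + F4 q (nLo q T) U ≤ 0 := by
    rw [boundary_add_F4_eq q _ hU0, hps]
    have hlogU : 6.75 ≤ Real.log U := hlogT.trans (Real.log_le_log hT0 hTU)
    have : 0 ≤ (Real.log U + (Real.log q - 1 - Real.log (2 * π)) + 4 / 3) / (3 * π) * (U ^ 3)⁻¹ := by
      have : 0 ≤ Real.log U + (Real.log q - 1 - Real.log (2 * π)) + 4 / 3 := by linarith
      positivity
    have : (0 : ℝ) ≤ 12.975 / 4 * (U ^ 4)⁻¹ := by positivity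
    linarith
  have hmain : -F4 q (nLo q T) T ≤ Real.log (q * T) / (2 * π * T ^ 3) := by
    rw [neg_F4_nLo_eq q hT0, hps, Real.log_mul hq0.ne' hT0.ne']
    set L := Real.log q with hL
    have e2 : (L + Real.log T) / (2 * π * T ^ 3) =
        (Real.log T + (L - 1 - Real.log (2 * π)) + 4 / 3) / (3 * π) * (T ^ 3)⁻¹
          + (L + Real.log T + 2 * Real.log (2 * π) - 2 / 3) / (6 * π) * (T ^ 3)⁻¹ := by
      field_simp
      ring
    rw [e2]
    have key : (2 * 12.975 * Real.log T + 12.975 / 4 + 2 * remC q) * (T ^ 4)⁻¹ ≤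
        (L + Real.log T + 2 * Real.log (2 * π) - 2 / 3) / (6 * π) * (T ^ 3)⁻¹ := by
      rw [show (T ^ 4)⁻¹ = T⁻¹ * (T ^ 3)⁻¹ by rw [← mul_inv, ← pow_succ'], ← mul_assoc]
      refine mul_le_mul_of_nonneg_right ?_ (by positivity)
      rw [← div_eq_mul_inv, div_le_div_iff₀ hT0 (by positivity)]
      have hB : 6 * π ≤ 18.9 := by linarith [Real.pi_lt_d2]
      have hlogT0 : 0 ≤ Real.log T := by linarith
      have hX : 2 * 12.975 * Real.log T + 12.975 / 4 + 2 * remC q ≤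
          25.95 * Real.log T + 25.95 * L + 72.49 := by linarith
      have hX0 : 0 ≤ 2 * 12.975 * Real.log T + 12.975 / 4 + 2 * remC q := by positivity
      have hP1 : 1000 * L ≤ T * L := mul_le_mul_of_nonneg_right hT hL0
      have hP2 : 1000 * Real.log T ≤ T * Real.log T := mul_le_mul_of_nonneg_right hT hlogT0
      calc (2 * 12.975 * Real.log T + 12.975 / 4 + 2 * remC q) * (6 * π)
          ≤ (25.95 * Real.log T + 25.95 * L + 72.49) * 18.9 := mul_le_mul hX hB (by positivity) (by positivity)
        _ ≤ (L + Real.log T + 2 * Real.log (2 * π) - 2 / 3) * T := by nlinarith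
    linarith
  linarith [h, hbd, hint_le, hFTC, hrem, hmain]

/-- **Item `LiFarTailsChar` of route `LiDirichletAsymptotic`** (stmt-RiemannHypothesis-19632; support S2χ), closed BY NAME. -/
theorem liFarTailsChar_proof :
    Summit.RiemannHypothesis.RiemannHypothesis.Theses.LiDirichletAsymptotic.LiFarTailsChar :=
  fun q _ χ hχ hq _ _ hT hTU ↦
    ⟨charInvMomentTail_three_le q χ hχ hq hT hTU, charInvMomentTail_four_le q χ hχ hq hT hTU⟩

end Summit.RiemannHypothesis.RiemannHypothesis.Theorems.LiTheory

end
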